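import Summits.QuantumAdvantage.QuantumAdvantage.Theorems.HintDialLowDegree

/-!
# HintDialAnfLadder — module 9/10 of the HintDial THEOREMS package (cell decomp-qadv, lens-3 generation 6)

§9: the ANF LADDER record of route `AnfPresentation` CLOSED BY NAME — `anfPresentation_rungAC0` (item 27988 `RungAC0`), `anfPresentation_rungP`
(27990 `RungP`), `anfPresentation_quadRungAC0` (27987 `QuadRungAC0`, the PARITY planting read on the quadratic sub-promise), `anfPresentation_firstRungEdges`
(27993 `FirstRungEdges`), `anfPresentation_coreEdges` (29123 `CoreEdges`); edges `rungA_of_quadRungA`, `rungA_of_anfResidual`.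

Provenance: split of the farm-checked single file `HintDialTheorems.lean` (HOME/decomp-qadv-lens-3/g6/tree/; rc 0 · no proof holes ·
axioms ⊆ {propext, Classical.choice, Quot.sound}); mathematical record: HOME/decomp-qadv-lens-3/g6/NODE-g6.md.  Modules in order:
HintDialDuality → HintDialLevels → HintDialAutomaton → HintDialLeakLaw → HintDialPlanting → HintDialClosure → HintDialTable → HintDialLowDegree → HintDialAnfLadder → HintDialCovariance (each imports its predecessor).  Namespace `Summit.QuantumAdvantage.QuantumAdvantage.Theorems.HintDial`.
-/

set_option linter.dupNamespace false

noncomputable section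

namespace Summit.QuantumAdvantage.QuantumAdvantage.Theorems.HintDial

open Summit.QuantumAdvantage.QuantumAdvantage.Theses.AnfPresentation
  (RungA LiftA NearExactIsExact SignedExactSliceIsLift AnfEquiv RungANonuniform)

open Finset
open Literature.Computability.Complexity
open Literature.Computability.QuantumComplexity
open Literature.Computability.MetaComplexity
open _root_.Computability (encodeNat)
/-! ## §9 THE ANF LADDER OF `AnfPresentation` CLOSED BY NAME (generation 6, v1.4).  The route's first-rung record items are
THEOREMS of this package: `RungAC0` (27988) and `RungP` (27990) are the plain-`AC⁰` rows of the dial (§5a, via `AC⁰ ⊆ AC⁰[3]` and the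
PARITY planting); `QuadRungAC0` (27987) is the same planting read on the QUADRATIC sub-promise (the planted tables `F_w, G_w⁰` are
two-sided bilinear tables, all of whose cube entries sit on the diagonal `i = j`); `FirstRungEdges` (27993) and `CoreEdges` (29123) are
sub-promise / class monotonicity (`Literature.Computability.Complexity.promiseLift_anti`, `promiseLift_mono`, `PromiseP ⊆ PromiseBPP'`). -/

section AnfLadder

open Summit.QuantumAdvantage.QuantumAdvantage.Theses.AnfPresentation
  (QuadRungAC0 RungAC0 QuadRungA RungP AnfResidual FirstRungEdges CoreEdges)

/-- ★ closes item 27988 `AnfPresentation.RungAC0` BY NAME: the exact slice is outside `promiseLift AC⁰`. -/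
theorem anfPresentation_rungAC0 : RungAC0 := signedExact_not_AC0

/-- ★ closes item 27990 `AnfPresentation.RungP` BY NAME: the exact slice is outside `promiseLift (AC⁰ ∩ P)`. -/
theorem anfPresentation_rungP : RungP := rungA_AC0

/-- The planted parity instances are syntactically QUADRATIC (every cube entry of a two-sided table lies on `i = j`). -/
theorem Automaton.quad_blTable {k : ℕ} (c : Bool) (α : Fin k → Bool) (M : Fin k → Fin k → Bool) (β : Fin k → Bool) :
    ∀ i j l : Fin (k + k), (Automaton.blTable k c α M β).cube i j l = true → (i = j ∨ j = l ∨ i = l) :=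
  fun _ _ _ h => Or.inl (Automaton.blTable_cube_eq_true h)

/-- ★ closes item 27987 `AnfPresentation.QuadRungAC0` BY NAME: the QUADRATIC exact sub-slice is outside `promiseLift AC⁰`
(PARITY planting into bilinear tables + `AC⁰ ⊆ AC⁰[3]` + Smolensky `MOD₂ ∉ AC⁰[3]`). -/
theorem anfPresentation_quadRungAC0 : QuadRungAC0 := by
  intro h
  refine Automaton.not_promiseLift_AC0Mod_of_proj Nat.prime_three Nat.prime_two (by decide) _
    (fun _ w => (Automaton.instP w).encode) (fun _ => Automaton.isProj_encode_instP) Automaton.uPoly2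
    (fun _ w => Automaton.length_encode_instP_le w) (fun _ w hw => ?_) (fun _ w hw => ?_) (promiseLift_mono (AC0_subset_AC0Mod 3) h)
  · exact ⟨Automaton.instP w, ⟨(CubicANFPair.encode_mem_yes_iff _).1 (Automaton.instP_mem_yes w hw),
      Automaton.quad_blTable _ _ _ _, Automaton.quad_blTable _ _ _ _⟩, rfl⟩
  · exact ⟨Automaton.instP w, ⟨(CubicANFPair.encode_mem_no_iff _).1 (Automaton.instP_mem_no w hw),
      Automaton.quad_blTable _ _ _ _, Automaton.quad_blTable _ _ _ _⟩, rfl⟩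

/-- `QuadRungA → RungA` (the quadratic sub-slice is a sub-promise of the slice). -/
theorem rungA_of_quadRungA : QuadRungA → RungA :=
  fun hq h => hq (Literature.Computability.Complexity.promiseLift_anti (Set.image_mono fun _ hI => hI.1) (Set.image_mono fun _ hI => hI.1) h)

/-- `AnfResidual → RungA` (`promiseLift (AC⁰[⊕] ∩ P) ⊆ PromiseP ⊆ PromiseBPP'`). -/
theorem rungA_of_anfResidual : AnfResidual → RungA :=
  fun hres h => hres (PromiseP_subset_PromiseBPP' (promiseLift_mono Set.inter_subset_right h))

/-- ★ closes item 27993 `AnfPresentation.FirstRungEdges` BY NAME (all six edges; the first three have PROVED consequents). -/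
theorem anfPresentation_firstRungEdges : FirstRungEdges :=
  ⟨fun _ => anfPresentation_rungAC0, fun _ => anfPresentation_rungP, fun _ => anfPresentation_rungP,
    rungA_of_quadRungA, rungA_of_rungANonuniform, rungA_of_anfResidual⟩

/-- ★ closes item 29123 `AnfPresentation.CoreEdges` BY NAME (sub-promise monotonicity + the dispatch logic). -/
theorem anfPresentation_coreEdges : CoreEdges := by
  delta CoreEdges
  intro pL quad mm quadS coreS mmS
  have hcore : SignedExactCubicSliceANF ∈ pL → coreS ∈ pL :=
    Literature.Computability.Complexity.promiseLift_anti (Set.image_mono fun _ hI => hI.1) (Set.image_mono fun _ hI => hI.1)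
  have hmm : coreS ∈ pL → mmS ∈ pL :=
    Literature.Computability.Complexity.promiseLift_anti (Set.image_mono fun _ hI => hI.1) (Set.image_mono fun _ hI => hI.1)
  exact ⟨fun hc h => hc (hcore h), fun hm hc => hm (hmm hc),
    fun disp hq => ⟨fun hA hc => hA (disp hq hc), fun hc h => hc (hcore h)⟩⟩

end AnfLadder

end Summit.QuantumAdvantage.QuantumAdvantage.Theorems.HintDial

end
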